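import Mathlib
import Literature.Analysis.FluidPDE.Tao2016AveragedNS.ShiftSetCascadeFlows
import Literature.Analysis.FluidPDE.Tao2016AveragedNS.ShiftSetCascadeFlux
import Summits.NavierStokesRegularity.NavierStokesRegularity.Theorems.TaoLadderRungTwoFlatCertificateGlueWrapperOn
import Summits.NavierStokesRegularity.NavierStokesRegularity.Theorems.TaoLadderRungTwoFlatCertificateGlueStaticsWakeOn
import Summits.NavierStokesRegularity.NavierStokesRegularity.Theorems.TaoLadderRungTwoFlatCertificateGlueStaticsQuietOn
import HarnessLib

/-!
# Certificate glue on a shift set `𝕊`, IX: THE REGISTERED STUB `stub_rung_quarter` FROM A WINDOW CERTIFICATE AND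
  FINITELY MANY SCALAR CHECKS (helper for item stmt-NavierStokesRegularity-22987 `FlatGapCertificatesV2`, crux K_A♭ of
  route TaoLadderRungTwoFlat; cell harvest/h2-tao-ladder, p1 g13)

`stub_rung_quarter_of_checks`: the end of the glue chain for the ε₀ = 1/4 frontier rung of the flat line. For the table
`mirrorTable (1/2) (1/2)` on `S♭` with the STANDARD certificate shapes (window-supported core on the window `[-Kb, Ka]`,
`Ka ≥ 4`; geometric reference wake `Cb (5/4)^{γ|j|}`, `0 ≤ γ ≤ 1`, flow wake envelope `2(Zb + r/Cw)`; two-level quiet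
profile `ν₀, ν₁`; weights `Cw 2^{k²/2+bk}` ahead / `Cw` behind), the registered stub's statement follows from DATA, nine
SCALAR inequalities (`hMZf`, `checkB₁`, `checkB₂`, `hMν`, `checkA₁…checkA₆` — each a closed-form number once the data are
dyadic rationals) and the three DYNAMICAL CLAUSES about the finite window system (`hinside`, `htrap`, `hland`; glue IV) —
i.e. from what a kernel-checkable validated integration of the 2(Kb+Ka+1)-dimensional window ODE with two interval edge
inputs delivers.

HONEST FRAMING: Tao-type MODEL lattice; the three clauses and the nine checks are HYPOTHESES — nothing is certified and no
stub is closed by this file; nothing here is a statement about the Navier–Stokes equations.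
-/

noncomputable section

-- the sub-problem namespace repeats the summit name by design (D-0017)
set_option linter.dupNamespace false

namespace Summit.NavierStokesRegularity.NavierStokesRegularity.Theorems

open Set Filter Topology MeasureTheory intervalIntegral Literature.Analysis.FluidPDE
  Literature.Analysis.FluidPDE.TaoCascade
open Summit.NavierStokesRegularity.NavierStokesRegularity.Theorems.GappedFrontRobustOn

namespace CertificateGlueOn

/-- **THE REGISTERED STUB `stub_rung_quarter` FROM A WINDOW CERTIFICATE AND FINITELY MANY SCALAR CHECKS** (glue VII's
`stub_rung_quarter_of_windowCertificate` with every `∀`-static discharged by glue VIII for the standard shapes; see the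
module docstring). [cite: Tao2016AveragedNS, §6.3–6.4 Props. 6.4–6.5 (statement shape of a renormalisation certificate); route TaoLadderRungTwoFlat, crux K_A♭, stub_rung_quarter] -/
theorem stub_rung_quarter_of_checks {X₀ : Fin 2 → ℝ} (hX₀ : X₀ 0 ≠ 0)
    -- window, weights, radius, contraction, exponents, clocks, slack
    {Kb Ka : ℤ} (hKb : 0 ≤ Kb) (hKa : 4 ≤ Ka) {Core : (Fin 2 → ℤ → ℝ) → Prop} {M w : ℤ → ℝ}
    {r ρ θ₀ θ c₀ c σ : ℝ} (hr : 0 < r) (hρ : 0 ≤ ρ) (hρ1 : ρ < 1) (hθ₀ : 0 ≤ θ₀) (hθ₀θ : θ₀ < θ)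
    (hθ : θ ≤ 1 / 2) (hc₀ : 0 < c₀) (hc₀c : c₀ < c) (hσ : 0 < σ)
    {Mmax : ℝ} (hMmax : ∀ k, -Kb ≤ k → k ≤ Ka → M k ≤ Mmax)
    (hcore : ∀ z z' : Fin 2 → ℤ → ℝ, (∀ i k, -Kb ≤ k → k ≤ Ka → z i k = z' i k) → Core z → Core z')
    (hdatum : Core (datumState (0 : Fin 2) X₀))
    -- the piecewise-Gaussian weight
    {Cw b : ℝ} (hCw : 1 ≤ Cw) (hb : 1 / 2 ≤ b)
    (hwp : ∀ k : ℤ, 0 ≤ k → w k = Cw * (2 : ℝ) ^ ((k : ℝ) ^ 2 / 2 + b * k))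
    (hwn : ∀ k : ℤ, k < 0 → w k = Cw)
    -- wake side: geometric reference envelope and its two scalar checks
    {Zb Zf : ℤ → ℝ} {Cb γ : ℝ} (hCb : 0 < Cb) (hγ0 : 0 ≤ γ) (hγ1 : γ ≤ 1)
    (hZb : ∀ j : ℤ, Zb j = Cb * (1 + (1 / 4 : ℝ)) ^ (-(γ * j)))
    (hZf : ∀ j : ℤ, Zf j = 2 * (Zb j + r / Cw)) (hMZf : M (-Kb) ≤ Zf (-Kb))
    (checkB₁ : 32 * c * 28 * (1 + (1 / 4 : ℝ)) ^ (2 * γ) *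
      ((1 + (1 / 4 : ℝ)) ^ ((5 : ℝ) * ((-Kb - 1 : ℤ) : ℝ) / 2) * (Zb (-Kb - 1) + r / Cw)) ≤ 1)
    (checkB₂ : (1 + (1 / 4 : ℝ)) ^ θ₀ * (Zb (-Kb - 1) + r / Cw +
      32 * c * 28 * (1 + (1 / 4 : ℝ)) ^ (2 * γ) *
        ((1 + (1 / 4 : ℝ)) ^ ((5 : ℝ) * ((-Kb - 1 : ℤ) : ℝ) / 2) * (Zb (-Kb - 1) + r / Cw) ^ 2)) ≤ Zb (-Kb - 1 - 1))
    -- quiet side: two-level profile and its scalar checks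
    {ν : ℤ → ℝ} {ν₀ ν₁ ϑ : ℝ} (hcoreTop : ∀ z, Core z → ∀ i, 4 * (w Ka * |z i Ka|) ≤ r)
    (hνKa : ν Ka = ν₀) (hνhi : ∀ K : ℤ, Ka + 1 ≤ K → ν K = ν₁) (hν₀ : 0 ≤ ν₀) (hν₁ : 0 ≤ ν₁)
    (hMν : M Ka ≤ ν₀ * r / w (Ka - 1))
    (checkA₁ : (1 + (1 / 4 : ℝ)) ^ ((5 : ℝ) * ((Ka + 1 : ℤ) : ℝ) / 2) * r * w (Ka + 1 - 1) ≤ ϑ * w (Ka + 1 - 2) ^ 2)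
    (checkA₂ : (1 + (1 / 4 : ℝ)) ^ ((5 : ℝ) * ((Ka : ℤ) : ℝ) / 2) *
      coeffAbsOn (botShifts shiftSetFlat) (mirrorTable (1 / 2) (1 / 2)) * c * (ν₀ * r / w (Ka - 1)) ≤ 1 / 2)
    (checkA₃ : (1 + (1 / 4 : ℝ)) ^ ((5 : ℝ) * ((Ka + 1 : ℤ) : ℝ) / 2) *
      coeffAbsOn (botShifts shiftSetFlat) (mirrorTable (1 / 2) (1 / 2)) * c * (ν₁ * r / w Ka) ≤ 1 / 2)
    (checkA₄ : 2 * (Real.sqrt 2 * Real.sqrt (4 / 3 * (2 : ℕ) * (25 / 32)) / (2 * (1 + (1 / 4 : ℝ)) ^ ((Ka : ℤ) : ℝ)) +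
      coeffAbsOn (botShifts shiftSetFlat) (mirrorTable (1 / 2) (1 / 2)) * c *
        (ϑ / (1 + (1 / 4 : ℝ)) ^ ((5 : ℝ) / 2)) * ν₀ ^ 2) ≤ ν₁)
    (checkA₅ : 2 * (Real.sqrt 2 * Real.sqrt (4 / 3 * (2 : ℕ) * (25 / 32)) / (2 * (1 + (1 / 4 : ℝ)) ^ ((Ka + 1 : ℤ) : ℝ)) +
      coeffAbsOn (botShifts shiftSetFlat) (mirrorTable (1 / 2) (1 / 2)) * c *
        (ϑ / (1 + (1 / 4 : ℝ)) ^ ((5 : ℝ) / 2)) * ν₁ ^ 2) ≤ ν₁)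
    (checkA₆ : ν₁ * (1 + (1 / 4 : ℝ)) ^ θ₀ ≤ ρ)
    -- the certificate's interior, trapping and landing clauses
    (hinside : ∀ (z S₀ : Fin 2 → ℤ → ℝ), Core z →
      (∀ i k, -Kb ≤ k → k ≤ Ka → w k * |S₀ i k - z i k| ≤ r) → ∀ i k, -Kb ≤ k → k ≤ Ka → |S₀ i k| < M k)
    (htrap : ∀ (s : ℝ) (z : Fin 2 → ℤ → ℝ) (S : Fin 2 → ℤ → ℝ → ℝ), Core z → 0 < s → s ≤ c →
      (∀ i k, -Kb ≤ k → k ≤ Ka → w k * |S i k 0 - z i k| ≤ r) →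
      (∀ i k, -Kb ≤ k → k ≤ Ka → ∀ u ∈ Icc 0 s,
        HasDerivWithinAt (S i k) (quadTermOn shiftSetFlat (1 / 4) (mirrorTable (1 / 2) (1 / 2)) S i k u) (Icc 0 s) u) →
      (∀ i, ContinuousOn (S i (-Kb - 1)) (Icc 0 s)) → (∀ i, ContinuousOn (S i (Ka + 1)) (Icc 0 s)) →
      (∀ i, ∀ u ∈ Icc 0 s, |S i (-Kb - 1) u| ≤ Zf (-Kb - 1)) →
      (∀ i, ∀ u ∈ Icc 0 s, |S i (Ka + 1) u| ≤ ν (Ka + 1) * r / w Ka) →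
      (∀ i k, -Kb ≤ k → k ≤ Ka → ∀ u ∈ Icc 0 s, |S i k u| ≤ M k) →
        ∀ i k, -Kb ≤ k → k ≤ Ka → ∀ u ∈ Icc 0 s, |S i k u| < M k)
    (hland : ∀ (z : Fin 2 → ℤ → ℝ) (S : Fin 2 → ℤ → ℝ → ℝ), Core z →
      (∀ i k, -Kb ≤ k → k ≤ Ka → w k * |S i k 0 - z i k| ≤ r) →
      (∀ i k, -Kb ≤ k → k ≤ Ka → ∀ u ∈ Icc 0 c₀,
        HasDerivWithinAt (S i k) (quadTermOn shiftSetFlat (1 / 4) (mirrorTable (1 / 2) (1 / 2)) S i k u) (Icc 0 c₀) u) →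
      (∀ i, ContinuousOn (S i (-Kb - 1)) (Icc 0 c₀)) → (∀ i, ContinuousOn (S i (Ka + 1)) (Icc 0 c₀)) →
      (∀ i, ∀ u ∈ Icc 0 c₀, |S i (-Kb - 1) u| ≤ Zf (-Kb - 1)) →
      (∀ i, ∀ u ∈ Icc 0 c₀, |S i (Ka + 1) u| ≤ ν (Ka + 1) * r / w Ka) →
      (∀ i k, -Kb ≤ k → k ≤ Ka → ∀ u ∈ Icc 0 c₀, |S i k u| ≤ M k) →
        ∃ (τ₁ a : ℝ) (z' : Fin 2 → ℤ → ℝ), 0 < τ₁ ∧ τ₁ ≤ c₀ ∧ 0 < a ∧ (1 + (1 / 4 : ℝ)) ^ (-θ₀) ≤ a ∧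
          (1 + σ) * a ≤ |S 0 1 τ₁| ∧ Core z' ∧
          (∀ i k, -Kb ≤ k → k + 1 ≤ Ka → w k * |S i (1 + k) τ₁ / a - z' i k| ≤ ρ * r) ∧
          (∀ (i : Fin 2) (v : ℝ), |v| ≤ ν (Ka + 1) * r / w Ka → w Ka * |v / a - z' i Ka| ≤ ρ * r) ∧
          (∀ i, |S i (-Kb) τ₁| ≤ a * Zb (-Kb - 1))) :
    ∃ (σ : ℝ) (X₀ : Fin 2 → ℝ) (Z : Set (Fin 2 → ℤ → ℝ)) (w : ℤ → ℝ) (r ρ θ₀ θ c₀ c : ℝ) (env₀ : ℤ → ℝ),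
      X₀ 0 ≠ 0 ∧
        GapData₂On shiftSetFlat σ (1 / 4) (0 : Fin 2) (mirrorTable (1 / 2) (1 / 2)) X₀ Z w r ρ θ₀ θ c₀ c env₀ ∧
          TailThin (1 / 4) w r ∧
            ∃ (Cw b : ℝ), 1 ≤ Cw ∧ 1 / 2 ≤ b ∧ ∀ k : ℤ, 0 ≤ k → w k = Cw * (2 : ℝ) ^ ((k : ℝ) ^ 2 / 2 + b * k) := by
  have hε : (0 : ℝ) < 1 / 4 := by norm_num
  have hε1 : (1 / 4 : ℝ) ≤ 1 := by norm_num
  have hr0 : 0 ≤ r := hr.le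
  have hc : 0 ≤ c := by linarith
  have hC28 : (0 : ℝ) ≤ 28 := by norm_num
  have hCbot0 : 0 ≤ coeffAbsOn (botShifts shiftSetFlat) (mirrorTable (1 / 2) (1 / 2)) := coeffAbsOn_nonneg _ _
  have hCbotc : 0 ≤ coeffAbsOn (botShifts shiftSetFlat) (mirrorTable (1 / 2) (1 / 2)) * c :=
    mul_nonneg hCbot0 hc
  -- wake statics
  obtain ⟨hZfpos, hZmin', hZb0, hZbf⟩ := wake_signs (Kb := Kb) hε hCb hγ0 hr0 hCw hZb hZf hwn hKb
  have hZmin : (0 : ℝ) < 2 * Cb := by positivity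
  have hcloseB := wake_closing (Kb := Kb) hε hCb hγ0 hγ1 hr0 hCw hc hC28 hZb hZf checkB₁
  have hDmax := wake_drift (Kb := Kb) hε hCb hγ0 hγ1 hr0 hCw hc hC28 hZb hZf
  have hshiftB := wake_shift (θ₀ := θ₀) hε hCb hγ0 hγ1 hr0 hCw hc hC28 hZb hZf hwn hKb checkB₂
  have hZbt : ∀ j, j < -Kb → Zb j ≤ Cb * (1 + (1 / 4 : ℝ)) ^ (-(j : ℝ)) := fun j hj =>
    wake_tame hε hCb hγ1 hZb j (by omega)
  -- quiet statics
  obtain ⟨hν, hνmax⟩ := quiet_signs (Ka := Ka) hνKa hνhi hν₀ hν₁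
  have hthin := quiet_thin (Ka := Ka) hε hε1 hCw hb hwp hwn hKa hr0 checkA₁
  have hslowA := quiet_slow (Ka := Ka) hε hε1 hCw hb hwp hwn (by omega) hνKa hνhi hν₁ hCbotc hr0 checkA₂
    checkA₃
  have hcloseA' := quiet_closing (m := 2) (Ka := Ka) hε hνKa hνhi checkA₄ checkA₅
  have hcloseA : ∀ K : ℤ, Ka + 1 ≤ K →
      2 * (Real.sqrt 2 * Real.sqrt (4 / 3 * (2 : ℝ) * (25 / 32 + 0 * (1 + (1 / 4 : ℝ)) ^ ((2 : ℝ) * K))) /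
          (2 * (1 + (1 / 4 : ℝ)) ^ ((K - 1 : ℤ) : ℝ)) +
        coeffAbsOn (botShifts shiftSetFlat) (mirrorTable (1 / 2) (1 / 2)) * c *
          (ϑ / (1 + (1 / 4 : ℝ)) ^ ((5 : ℝ) / 2)) * ν (K - 1) ^ 2) ≤ ν K := by
    intro K hK
    have h := hcloseA' K hK
    have e : ((2 : ℕ) : ℝ) = (2 : ℝ) := by norm_num
    rw [e] at h
    exact h
  have hshiftA := quiet_shift (Ka := Ka) (θ₀ := θ₀) (ρ := ρ) hνhi checkA₆
  have hMν' : M Ka ≤ ν Ka * r / w (Ka - 1) := by rw [hνKa]; exact hMν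
  exact stub_rung_quarter_of_windowCertificate hX₀ hKb (by omega) hr hρ hρ1 hθ₀ hθ₀θ hθ hc₀ hc₀c hσ hMmax hcore
    hdatum hZfpos hZmin (fun j hj => hZmin' j hj) hZb0 hZbf hMZf hcloseB hDmax hshiftB hcoreTop hthin hν hνmax
    hcloseA hslowA hMν' hshiftA hinside htrap hland hCb.le hZbt hCw hb hwp hwn

end CertificateGlueOn

end Summit.NavierStokesRegularity.NavierStokesRegularity.Theorems

end
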